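import Summits.Ventures.QEC.CircuitDistance.PortBridge
import HarnessLib

/-!
# P3-PORT (C1): NORMAL fault sets — `Nc`-independence and δ = 1 locality of their columns; the columns of `InitZ` faults
# and `MeasZ` flips (cell `qec`, experiment CDX, seat qec-cdx-type-1)

* `Fault.isInitZ`, `Normal Nc F` (cycles in `1 … Nc`, no `InitZ` fault);
* `detZ_indep`/`detX_indep` (columns of normal faults do not depend on `Nc`), `detZ_local`/`detX_local` (layers `c, c+1`
  only), `sameCols_indep`, `transfer_normal` (a normal undetectable logical set lives in every long-enough circuit);
* `shape_eq_evolve_delta`, `shape_initZ`, `shape_measZ` and the explicit columns `detZ_initZ` (`(c+1, j), (c+2, j)` iff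
  cycle `c+1` exists), `detZ_measZ` (`(c, j), (c+1, j)`), `detX_initZ = detX_measZ = false`;
* `initZ_measZ_sameCols` (`InitZ@c ≡ MeasZ@(c+1)`, crit-1's δ-correction) and `initZ_last_sameCols` (`InitZ@Nc ≡ ∅`).
Generic in `S`; nothing here asserts a value of `d_circ`.
-/
namespace Summit.Ventures.QEC.CircuitDistance

open Literature.InformationTheory.QuantumCodes

variable {ℓ m : ℕ} [NeZero ℓ] [NeZero m]

/-! ## Normal fault sets and the `Nc`-independence / locality of their columns -/

omit [NeZero ℓ] [NeZero m] in
/-- Is this an `InitZ` fault? -/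
def Fault.isInitZ : Fault ℓ m → Bool
  | .initZ _ _ => true
  | _ => false

omit [NeZero ℓ] [NeZero m] in
/-- A fault set is NORMAL for the `Nc`-cycle circuit: every fault sits in a cycle `1 … Nc` and none is an `InitZ` fault. -/
def Normal (Nc : ℕ) (F : Finset (Fault ℓ m)) : Prop := ∀ f ∈ F, 1 ≤ f.cyc ∧ f.cyc ≤ Nc ∧ f.isInitZ = false

/-- A non-`InitZ` fault leaves no `ζ`. -/
theorem ancZx_of_not_initZ (S : SMCode ℓ m) (f : Fault ℓ m) (hf : f.isInitZ = false) (j : BB.Mono ℓ m) :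
    (shape S f).frame.ancZx j = false := by
  rw [shape_ancZx]
  cases f <;> simp_all [Fault.isInitZ]

/-- Columns of normal faults do not depend on `Nc` (`Z`-detectors). -/
theorem detZ_indep (S : SMCode ℓ m) {Nc Nc' : ℕ} (f : Fault ℓ m) (hf : f.isInitZ = false) (h₁ : 1 ≤ f.cyc)
    (h₂ : f.cyc ≤ Nc) (h₂' : f.cyc ≤ Nc') (t : ℕ) (j : BB.Mono ℓ m) : detZ S Nc {f} t j = detZ S Nc' {f} t j := by
  rw [detZ_singleton S Nc f h₁ h₂, detZ_singleton S Nc' f h₁ h₂', ancZx_of_not_initZ S f hf]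
  simp

/-- Columns of normal faults do not depend on `Nc` (`X`-detectors). -/
theorem detX_indep (S : SMCode ℓ m) {Nc Nc' : ℕ} (f : Fault ℓ m) (h₁ : 1 ≤ f.cyc) (h₂ : f.cyc ≤ Nc) (h₂' : f.cyc ≤ Nc')
    (t : ℕ) (i : BB.Mono ℓ m) : detX S Nc {f} t i = detX S Nc' {f} t i := by
  rw [detX_singleton S Nc f h₁ h₂, detX_singleton S Nc' f h₁ h₂']

/-- δ = 1 LOCALITY (`Z`-detectors): a normal fault of cycle `c` fires only layers `c`, `c+1`. -/
theorem detZ_local (S : SMCode ℓ m) (Nc : ℕ) (f : Fault ℓ m) (hf : f.isInitZ = false) (h₁ : 1 ≤ f.cyc) (h₂ : f.cyc ≤ Nc)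
    {t : ℕ} (ht : t ≠ f.cyc ∧ t ≠ f.cyc + 1) (j : BB.Mono ℓ m) : detZ S Nc {f} t j = false := by
  rw [detZ_singleton S Nc f h₁ h₂, ancZx_of_not_initZ S f hf, decide_eq_false ht.1, decide_eq_false ht.2]
  simp

/-- δ = 1 LOCALITY (`X`-detectors). -/
theorem detX_local (S : SMCode ℓ m) (Nc : ℕ) (f : Fault ℓ m) (h₁ : 1 ≤ f.cyc) (h₂ : f.cyc ≤ Nc)
    {t : ℕ} (ht : t ≠ f.cyc ∧ t ≠ f.cyc + 1) (i : BB.Mono ℓ m) : detX S Nc {f} t i = false := by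
  rw [detX_singleton S Nc f h₁ h₂, decide_eq_false ht.1, decide_eq_false ht.2]
  simp

/-- Set level: the columns of a normal set are the same in every long-enough circuit. -/
theorem sameCols_indep (S : SMCode ℓ m) {Nc Nc' : ℕ} (F : Finset (Fault ℓ m)) (hN : Normal Nc F)
    (hN' : ∀ f ∈ F, f.cyc ≤ Nc') :
    (∀ t i, detX S Nc' F t i = detX S Nc F t i) ∧ (∀ t j, detZ S Nc' F t j = detZ S Nc F t j) ∧
      dataX S Nc' F = dataX S Nc F ∧ dataZ S Nc' F = dataZ S Nc F := by
  refine ⟨fun t i => ?_, fun t j => ?_, ?_, ?_⟩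
  · rw [detX_eq_bsum, detX_eq_bsum S Nc]
    exact bsum_congr fun f hf => detX_indep S f (hN f hf).1 (hN' f hf) (hN f hf).2.1 t i
  · rw [detZ_eq_bsum, detZ_eq_bsum S Nc]
    exact bsum_congr fun f hf => detZ_indep S f (hN f hf).2.2 (hN f hf).1 (hN' f hf) (hN f hf).2.1 t j
  · rw [dataX_eq_sum, dataX_eq_sum S Nc]
    exact Finset.sum_congr rfl fun f hf => by
      rw [dataX_singleton S Nc' f (hN f hf).1 (hN' f hf), dataX_singleton S Nc f (hN f hf).1 (hN f hf).2.1]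
  · rw [dataZ_eq_sum, dataZ_eq_sum S Nc]
    exact Finset.sum_congr rfl fun f hf => by
      rw [dataZ_singleton S Nc' f (hN f hf).1 (hN' f hf), dataZ_singleton S Nc f (hN f hf).1 (hN f hf).2.1]

/-- A normal undetectable logical set of the `Nc`-circuit is one of any circuit containing its cycles. -/
theorem transfer_normal (S : SMCode ℓ m) {Nc Nc' : ℕ} (F : Finset (Fault ℓ m)) (hN : Normal Nc F)
    (hN' : ∀ f ∈ F, f.cyc ≤ Nc') (hU : Undetectable S Nc F) (hL : LogicalError S Nc F) :
    Undetectable S Nc' F ∧ LogicalError S Nc' F := by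
  obtain ⟨hX, hZ, hdX, hdZ⟩ := sameCols_indep S F hN hN'
  refine ⟨⟨fun f hf => ?_, fun t i => ⟨?_, ?_⟩⟩, ?_⟩
  · rw [mem_allEvents_iff, Fault.ev_cyc]; exact ⟨(hN f hf).1, hN' f hf⟩
  · rw [hX]; exact (hU.2 t i).1
  · rw [hZ]; exact (hU.2 t i).2
  · unfold LogicalError at hL ⊢; rw [hdX, hdZ]; exact hL

/-! ## Normalisation: `InitZ@c ↦ MeasZ@(c+1)`, `InitZ@Nc ↦ ∅` -/

/-- The shape of a fault in terms of the events after it. -/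
theorem shape_eq_evolve_delta (S : SMCode ℓ m) (f : Fault ℓ m) (pre post : List Ev)
    (h : cycleEvents f.cyc = pre ++ f.ev :: post) (hpre : f.ev ∉ pre) (hpost : f.ev ∉ post) :
    shape S f = evolve S post (delta S f) := by
  unfold shape
  rw [h, simulate_append, simulate_of_not_mem S f hpre, evolve_init, simulate_cons, if_pos rfl, applyEv_init,
    simulate_of_not_mem S f hpost]
  rfl

/-- Ideal operations keep an all-clear FRAME all-clear (outcome slots arbitrary). -/
theorem applyEv_frame_init (S : SMCode ℓ m) (e : Ev) (mX mZ : ℕ → BB.Mono ℓ m → Bool) :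
    applyEv S e ⟨State.init.frame, mX, mZ⟩ = ⟨State.init.frame, mX, mZ⟩ := by
  cases e <;> refine State.ext' ?_ ?_ ?_ <;> (try rfl) <;> funext q <;>
    simp [applyEv, State.init, Frame.cnotLayer, Frame.clearReg]

/-- Fault-free evolution keeps an all-clear frame all-clear. -/
theorem evolve_frame_init (S : SMCode ℓ m) (es : List Ev) (mX mZ : ℕ → BB.Mono ℓ m → Bool) :
    evolve S es ⟨State.init.frame, mX, mZ⟩ = ⟨State.init.frame, mX, mZ⟩ := by
  induction es with
  | nil => rfl
  | cons e es ih => rw [evolve_cons, applyEv_frame_init, ih]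

/-- The shape of an `InitZ` fault: an `X` on its ancilla, no outcome flips. -/
theorem shape_initZ (S : SMCode ℓ m) (c : ℕ) (j : BB.Mono ℓ m) :
    shape S (Fault.initZ c j) = ⟨State.init.frame.mulAt (Reg.Z, j) (true, false), fun _ _ => false, fun _ _ => false⟩ := by
  rw [shape_eq_evolve_delta S (Fault.initZ c j)
    [.initX c, .cnot c .A1RZ, .idle c .L1, .cnot c .A2XL, .cnot c .A3RZ, .cnot c .B2XR, .cnot c .B1LZ,
      .cnot c .B1XR, .cnot c .B2LZ, .cnot c .B3XR, .cnot c .B3LZ, .cnot c .A1XL, .cnot c .A2RZ, .cnot c .A3XL,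
      .measZ c, .idle c .R7, .measX c] [.idle c .L8, .idle c .R8] rfl (by simp [Fault.ev]) (by simp [Fault.ev])]
  rfl

/-- The shape of a `MeasZ` flip: no frame, one outcome flip. -/
theorem shape_measZ (S : SMCode ℓ m) (c : ℕ) (j : BB.Mono ℓ m) :
    shape S (Fault.measZ c j) = ⟨State.init.frame, fun _ _ => false, fun c' i' => if c' = c ∧ i' = j then true else false⟩ := by
  rw [shape_eq_evolve_delta S (Fault.measZ c j)
    [.initX c, .cnot c .A1RZ, .idle c .L1, .cnot c .A2XL, .cnot c .A3RZ, .cnot c .B2XR, .cnot c .B1LZ,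
      .cnot c .B1XR, .cnot c .B2LZ, .cnot c .B3XR, .cnot c .B3LZ, .cnot c .A1XL, .cnot c .A2RZ, .cnot c .A3XL]
      [.idle c .R7, .measX c, .initZ c, .idle c .L8, .idle c .R8] rfl (by simp [Fault.ev]) (by simp [Fault.ev])]
  have : delta S (Fault.measZ c j) = ⟨State.init.frame, fun _ _ => false, fun c' i' => if c' = c ∧ i' = j then true else false⟩ := by
    refine State.ext' rfl rfl ?_
    funext c' i'; simp [delta, inject, State.init]
  rw [this, evolve_frame_init]

/-- `synZ` of the zero error vanishes. -/
theorem synZ_zero (S : SMCode ℓ m) (j : BB.Mono ℓ m) : synZ S (fun _ => false) j = false := by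
  simp [synZ]

/-- `synX` of the zero error vanishes. -/
theorem synX_zero (S : SMCode ℓ m) (i : BB.Mono ℓ m) : synX S (fun _ => false) i = false := by
  simp [synX]

/-- Shape data of an `InitZ` fault: no `Z`-flips. -/
theorem mZ_initZ (S : SMCode ℓ m) (c t : ℕ) (j j' : BB.Mono ℓ m) : (shape S (Fault.initZ c j)).mZ t j' = false := by
  rw [shape_initZ]

/-- Shape data of an `InitZ` fault: no `X`-flips. -/
theorem mX_initZ (S : SMCode ℓ m) (c t : ℕ) (j i : BB.Mono ℓ m) : (shape S (Fault.initZ c j)).mX t i = false := by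
  rw [shape_initZ]

/-- Shape data of an `InitZ` fault: no data `X`-error. -/
theorem dataXb_initZ (S : SMCode ℓ m) (c : ℕ) (j : BB.Mono ℓ m) : (shape S (Fault.initZ c j)).frame.dataXb = fun _ => false := by
  rw [shape_initZ]; funext q; rcases q with i | i <;> simp [Frame.dataXb, Frame.mulAt, State.init]

/-- Shape data of an `InitZ` fault: no data `Z`-error. -/
theorem dataZb_initZ (S : SMCode ℓ m) (c : ℕ) (j : BB.Mono ℓ m) : (shape S (Fault.initZ c j)).frame.dataZb = fun _ => false := by
  rw [shape_initZ]; funext q; rcases q with i | i <;> simp [Frame.dataZb, Frame.mulAt, State.init]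

/-- Shape data of an `InitZ` fault: `ζ = e_j`. -/
theorem ancZx_initZ (S : SMCode ℓ m) (c : ℕ) (j j' : BB.Mono ℓ m) :
    (shape S (Fault.initZ c j)).frame.ancZx j' = decide (j' = j) := by
  rw [shape_ancZx]
  by_cases h : j' = j
  · subst h; simp [Fault.cyc]
  · simp [Fault.cyc, Ne.symm h, h]

/-- Shape data of a `MeasZ` flip: the one `Z`-flip. -/
theorem mZ_measZ (S : SMCode ℓ m) (c t : ℕ) (j j' : BB.Mono ℓ m) :
    (shape S (Fault.measZ c j)).mZ t j' = decide (t = c ∧ j' = j) := by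
  rw [shape_measZ]; dsimp only; split_ifs with h <;> simp [h]

/-- Shape data of a `MeasZ` flip: no `X`-flips. -/
theorem mX_measZ (S : SMCode ℓ m) (c t : ℕ) (j i : BB.Mono ℓ m) : (shape S (Fault.measZ c j)).mX t i = false := by
  rw [shape_measZ]

/-- Shape data of a `MeasZ` flip: no data `X`-error. -/
theorem dataXb_measZ (S : SMCode ℓ m) (c : ℕ) (j : BB.Mono ℓ m) : (shape S (Fault.measZ c j)).frame.dataXb = fun _ => false := by
  rw [shape_measZ]; funext q; rcases q with i | i <;> rfl

/-- Shape data of a `MeasZ` flip: no data `Z`-error. -/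
theorem dataZb_measZ (S : SMCode ℓ m) (c : ℕ) (j : BB.Mono ℓ m) : (shape S (Fault.measZ c j)).frame.dataZb = fun _ => false := by
  rw [shape_measZ]; funext q; rcases q with i | i <;> rfl

/-- Column of an `InitZ` fault: `Z`-detectors `(c+1, j)` and `(c+2, j)` if cycle `c+1` exists, else nothing. -/
theorem detZ_initZ (S : SMCode ℓ m) (Nc c : ℕ) (j : BB.Mono ℓ m) (h₁ : 1 ≤ c) (h₂ : c ≤ Nc) (t : ℕ) (j' : BB.Mono ℓ m) :
    detZ S Nc {Fault.initZ c j} t j' = (decide (c + 1 ≤ Nc) && decide (j' = j) && (decide (t = c + 1) || decide (t = c + 2))) := by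
  have hc : (Fault.initZ c j : Fault ℓ m).cyc = c := rfl
  rw [detZ_singleton S Nc (Fault.initZ c j) h₁ h₂, hc]
  simp only [mZ_initZ, dataXb_initZ, synZ_zero, ancZx_initZ]
  generalize decide (c + 1 ≤ Nc) = b4
  generalize decide (j' = j) = b5
  by_cases h1 : t = c + 1
  · rw [decide_eq_true h1, decide_eq_false (show ¬ t = c + 2 by omega), decide_eq_false (show ¬ t = c by omega)]
    cases b4 <;> cases b5 <;> rfl
  · rw [decide_eq_false h1]
    by_cases h2 : t = c + 2
    · rw [decide_eq_true h2, decide_eq_false (show ¬ t = c by omega)]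
      cases b4 <;> cases b5 <;> rfl
    · rw [decide_eq_false h2]
      generalize decide (t = c) = b1
      cases b1 <;> cases b4 <;> cases b5 <;> rfl

/-- Column of an `InitZ` fault: no `X`-detectors. -/
theorem detX_initZ (S : SMCode ℓ m) (Nc c : ℕ) (j : BB.Mono ℓ m) (h₁ : 1 ≤ c) (h₂ : c ≤ Nc) (t : ℕ) (i : BB.Mono ℓ m) :
    detX S Nc {Fault.initZ c j} t i = false := by
  have hc : (Fault.initZ c j : Fault ℓ m).cyc = c := rfl
  rw [detX_singleton S Nc (Fault.initZ c j) h₁ h₂, hc]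
  simp only [mX_initZ, dataZb_initZ, synX_zero]
  generalize decide (t = c) = b1
  generalize decide (t = c + 1) = b2
  cases b1 <;> cases b2 <;> rfl

/-- Column of a `MeasZ` flip: `Z`-detectors `(c, j)` and `(c+1, j)`. -/
theorem detZ_measZ (S : SMCode ℓ m) (Nc c : ℕ) (j : BB.Mono ℓ m) (h₁ : 1 ≤ c) (h₂ : c ≤ Nc) (t : ℕ) (j' : BB.Mono ℓ m) :
    detZ S Nc {Fault.measZ c j} t j' = (decide (j' = j) && (decide (t = c) || decide (t = c + 1))) := by
  have hc : (Fault.measZ c j : Fault ℓ m).cyc = c := rfl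
  rw [detZ_singleton S Nc (Fault.measZ c j) h₁ h₂, hc]
  simp only [mZ_measZ, dataXb_measZ, synZ_zero, ancZx_of_not_initZ S (Fault.measZ c j) rfl, true_and]
  generalize decide (c + 1 ≤ Nc) = b4
  generalize decide (j' = j) = b5
  by_cases h1 : t = c
  · rw [decide_eq_true h1, decide_eq_false (show ¬ t = c + 1 by omega), decide_eq_false (show ¬ t = c + 2 by omega)]
    cases b4 <;> cases b5 <;> rfl
  · rw [decide_eq_false h1]
    by_cases h2 : t = c + 1
    · rw [decide_eq_true h2, decide_eq_false (show ¬ t = c + 2 by omega)]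
      cases b4 <;> cases b5 <;> rfl
    · rw [decide_eq_false h2]
      generalize decide (t = c + 2) = b3
      cases b3 <;> cases b4 <;> cases b5 <;> rfl

/-- Column of a `MeasZ` flip: no `X`-detectors. -/
theorem detX_measZ (S : SMCode ℓ m) (Nc c : ℕ) (j : BB.Mono ℓ m) (h₁ : 1 ≤ c) (h₂ : c ≤ Nc) (t : ℕ) (i : BB.Mono ℓ m) :
    detX S Nc {Fault.measZ c j} t i = false := by
  have hc : (Fault.measZ c j : Fault ℓ m).cyc = c := rfl
  rw [detX_singleton S Nc (Fault.measZ c j) h₁ h₂, hc]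
  simp only [mX_measZ, dataZb_measZ, synX_zero]
  generalize decide (t = c) = b1
  generalize decide (t = c + 1) = b2
  cases b1 <;> cases b2 <;> rfl

/-- An `InitZ` fault of cycle `c` and the `MeasZ`-flip of cycle `c+1` on the same ancilla have IDENTICAL columns in every
circuit containing cycle `c+1`. -/
theorem initZ_measZ_sameCols (S : SMCode ℓ m) (Nc c : ℕ) (j : BB.Mono ℓ m) (h₁ : 1 ≤ c) (h₂ : c + 1 ≤ Nc) :
    SameCols S Nc {Fault.initZ c j} {Fault.measZ (c + 1) j} := by
  refine ⟨fun t i => ?_, fun t j' => ?_, ?_, ?_⟩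
  · rw [detX_initZ S Nc c j h₁ (by omega), detX_measZ S Nc (c + 1) j (by omega) h₂]
  · rw [detZ_initZ S Nc c j h₁ (by omega), detZ_measZ S Nc (c + 1) j (by omega) h₂, decide_eq_true h₂, Bool.true_and]
  · rw [dataX_singleton S Nc (Fault.measZ (c + 1) j) (show 1 ≤ c + 1 by omega) h₂,
      dataX_singleton S Nc (Fault.initZ c j) h₁ (show c ≤ Nc by omega), dataXb_initZ, dataXb_measZ]
  · rw [dataZ_singleton S Nc (Fault.measZ (c + 1) j) (show 1 ≤ c + 1 by omega) h₂,
      dataZ_singleton S Nc (Fault.initZ c j) h₁ (show c ≤ Nc by omega), dataZb_initZ, dataZb_measZ]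

/-- An `InitZ` fault of the LAST cycle has the zero column. -/
theorem initZ_last_sameCols (S : SMCode ℓ m) (Nc : ℕ) (j : BB.Mono ℓ m) (h : 1 ≤ Nc) :
    SameCols S Nc {Fault.initZ Nc j} ∅ := by
  have h0X : ∀ t i, detX S Nc (∅ : Finset (Fault ℓ m)) t i = false := fun t i => by rw [detX_eq_bsum]; exact bsum_empty _
  have h0Z : ∀ t j, detZ S Nc (∅ : Finset (Fault ℓ m)) t j = false := fun t j => by rw [detZ_eq_bsum]; exact bsum_empty _
  refine ⟨fun t i => ?_, fun t j' => ?_, ?_, ?_⟩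
  · rw [h0X, detX_initZ S Nc Nc j h le_rfl]
  · rw [h0Z, detZ_initZ S Nc Nc j h le_rfl, decide_eq_false (show ¬ Nc + 1 ≤ Nc by omega), Bool.false_and, Bool.false_and]
  · rw [dataX_singleton S Nc (Fault.initZ Nc j) h (le_refl Nc), dataXb_initZ, dataX_eq_sum, Finset.sum_empty]; rfl
  · rw [dataZ_singleton S Nc (Fault.initZ Nc j) h (le_refl Nc), dataZb_initZ, dataZ_eq_sum, Finset.sum_empty]; rfl

end Summit.Ventures.QEC.CircuitDistance
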